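import Summits.QuantumFields.YangMills.Theorems.BalabanUVNodesN19FixedTestLawPairs
import Summits.QuantumFields.YangMills.Theorems.BalabanUVNodesN19UniformMomentSummabilityThresholdSharp

/-!
# YM-DAG node N19 (= NE7 proper) — FIXED OBSERVABLES UNDER THE UNIFORM-MOMENT CURRENCY, V: ONE GEOMETRIC UNIFORM-MOMENT WITNESS ON WHICH THE
# BOUNDED-LIPSCHITZ INCREMENTS ARE NOT SUMMABLE WHILE EVERY FIXED LIPSCHITZ OBSERVABLE CONVERGES ABSOLUTELY (total `≤ (π³∕3)(K+B)`)

Cell `pub-ymgap`, HUMAN RULING D-0062 (Track A) ∕ D-0149 (work-bound push), R141 (C) wider-strategy seat `pub-ymgap-dag-n19-e` (strategy s3 =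
ALTERNATIVE CURRENCY), generation g24, module 5 (lineage module 89; parts I–IV = modules 85–88).  Route `Summits/QuantumFields/YangMills/Theses/BalabanUVNodes.lean`
rev 25, cluster item K3⁷ «SpineGivenEndpointR13SepCoPH» (stmt-QuantumFields-20544); filed `--supports` that item `--as helper` (it proves no registered
stub).  COUNT-NEUTRAL: [folklore] real analysis over Mathlib + module 88 (`exists_halfScale_chebyshevArc_laws_ident`, `sum_abs_increments_arcChain_le`),
module 79 (`not_summable_invLogRate_geometric`) and module 78 (`invLogRate_pos`, `invLogRate_posLog_inv_mono`) BY NAME; no scheme object, no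
Theses import; NOT a discharge claim.

THE DICHOTOMY ON ONE SEQUENCE.  ★★★ `exists_uniformMoments_geometric_fixedTests_summable`: for every `C > 0` and `0 < θ < 1` there is ONE sequence of
probability laws `Λ_K` on `[−1,1]` with ALL moments `Cθ^K`-close step to step (`|∫x^j dΛ_{K+1} − ∫x^j dΛ_K| ≤ Cθ^K` for every `j`) such that
(a) along suitable continuous tests `g_K`, `1`-Lipschitz and `1`-bounded on `[−1,1]`, the increments `|∫g_K dΛ_{K+1} − ∫g_K dΛ_K|` are NOT summable
(the bounded-Lipschitz metric does not converge absolutely — module 79's phenomenon), YET (b) for EVERY FIXED continuous test `G`, `K`-Lipschitz and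
`B`-bounded on `[−1,1]`, `Σ_K |∫G dΛ_{K+1} − ∫G dΛ_K| ≤ (π³∕3)(K+B) < ∞`.  CONTRAST: under the WINDOW currency at geometric remainders module 83
(`…N19TargetFixedTestNotSummable`) has ONE fixed Lipschitz observable with `Σ = ∞`; the uniform currency's natural witnesses show no such phenomenon.
THE SEQUENCE.  Module 79's budget-driven half-scale arc chain with STRICTLY INCREASING levels: `b_j = 2(½)^{3+j}`, `J_i = Nat.find(2b_j ≤ Cθ^{2i+1})`
(monotone), levels `ℓ_i = J_i + i` (strictly increasing, still affordable since `b` is antitone), `Λ_{2i} = P'_{ℓ_i}`, `Λ_{2i+1} = Q'_{ℓ_i}` (module 88's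
half-scale laws WITH identities at `n = 3 + ℓ_i`); every step costs `≤ 2b_{J_i} ≤ Cθ^{2i+1}` in EVERY moment.  (a) the even steps pay the level test
`1∕(4(3+ℓ_i))` and THE INVERSION `3 + J_i + i ≤ M₀(1 + log⁺(Cθ^{2i+1})⁻¹)` (`J_i ≤ 2log⁺r⁻¹` by minimality, `i ≤ (log⁺r⁻¹ + |log C|)∕(2log θ⁻¹)`;
`M₀ = max(3 + |log C|∕(2log θ⁻¹), 2 + 1∕(2log θ⁻¹))`) transfers summability to `Σ_K 1∕(1+log⁺(Cθ^K)⁻¹)`, which diverges (module 79); (b) each level is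
visited exactly twice, so module 88's arc-chain bound with `m = 2`, `s = ½` gives `2·(π³∕6)(K+B)`.

HONEST FRAMING (binding).  Elementary and [folklore] (Bessel ∕ Chebyshev–Favard arcs); toy laws, no scheme object; NO consumer in the DAG today (a structural
statement about the seat's own currencies: what N19's uniform target does and does not buy for fixed observables); nothing of Bałaban's instantiated; NE7
NOT PRINTED, NOT proved; N19 NOT discharged; count-neutral.  One finite `T⁴` programme at fixed `ε`; nothing continuum ∕ `ℝ⁴` ∕ OS ∕ mass-gap ∕ Clay.
0 `def` ∕ 0 `sorry`.
-/

noncomputable section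

open Real Finset MeasureTheory ProbabilityTheory

namespace Summit.QuantumFields.YangMills.Theorems.BalabanUVNodesN19UniformMomentsFixedTestsSummable

open Summit.QuantumFields.YangMills.Theorems.BalabanUVNodesN19UniformMomentSummabilityThreshold (invLogRate_pos invLogRate_le_one
  invLogRate_posLog_inv_mono)
open Summit.QuantumFields.YangMills.Theorems.BalabanUVNodesN19UniformMomentSummabilityThresholdSharp (not_summable_invLogRate_geometric)
open Summit.QuantumFields.YangMills.Theorems.BalabanUVNodesN19FixedTestLawPairs (exists_halfScale_chebyshevArc_laws_ident
  sum_abs_increments_arcChain_le)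

/-- Multiplicity two: if `ℓ` is strictly monotone then every value of `K ↦ 3 + ℓ(K∕2)` is taken by at most two `K`. [bookkeeping] -/
theorem card_filter_level_le_two {ℓ : ℕ → ℕ} (hℓ : StrictMono ℓ) (n L : ℕ) :
    ((Finset.range L).filter (fun K => 3 + ℓ (K / 2) = n)).card ≤ 2 := by
  classical
  set S := (Finset.range L).filter (fun K => 3 + ℓ (K / 2) = n) with hS
  rcases S.eq_empty_or_nonempty with h | ⟨K₀, hK₀⟩
  · rw [h]; simp
  · have hq : ∀ K ∈ S, K / 2 = K₀ / 2 := fun K hK => by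
      have e1 := (Finset.mem_filter.1 hK).2
      have e0 := (Finset.mem_filter.1 hK₀).2
      exact hℓ.injective (by omega)
    have hsub : S ⊆ {2 * (K₀ / 2), 2 * (K₀ / 2) + 1} := fun K hK => by
      have h1 := hq K hK
      have h2 := Nat.div_add_mod K 2
      have h3 := Nat.mod_two_eq_zero_or_one K
      rw [Finset.mem_insert, Finset.mem_singleton]
      omega
    exact (Finset.card_le_card hsub).trans (Finset.card_le_two)

/-- ★★★ **ONE GEOMETRIC UNIFORM-MOMENT WITNESS: BOUNDED-LIPSCHITZ INCREMENTS NOT SUMMABLE, EVERY FIXED LIPSCHITZ OBSERVABLE ABSOLUTELY SUMMABLE.**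
For `C > 0` and `0 < θ < 1` there is a sequence of probability laws `Λ_K` on `[−1,1]` with `|∫x^j dΛ_{K+1} − ∫x^j dΛ_K| ≤ Cθ^K` for EVERY `j` and `K`,
continuous tests `g_K` (`1`-Lipschitz, `1`-bounded on `[−1,1]`) with `Σ_K |∫g_K dΛ_{K+1} − ∫g_K dΛ_K| = ∞`, and such that for EVERY FIXED continuous
`G`, `K`-Lipschitz and `B`-bounded on `[−1,1]`, the increments `|∫G dΛ_{K+1} − ∫G dΛ_K|` are summable with sum `≤ (π³∕3)(K+B)`.
(Module 79's half-scale arc chain with strictly increasing levels; (b) by modules 85–88: Bessel on the odd harmonics of the triangle waves.) [folklore] -/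
theorem exists_uniformMoments_geometric_fixedTests_summable {C θ : ℝ} (hC : 0 < C) (hθ0 : 0 < θ) (hθ1 : θ < 1) :
    ∃ Λ : ℕ → Measure ℝ, (∀ K, IsProbabilityMeasure (Λ K)) ∧ (∀ K, Λ K (Set.Icc (-1 : ℝ) 1)ᶜ = 0) ∧
      (∀ K j : ℕ, |∫ x, x ^ j ∂Λ (K + 1) - ∫ x, x ^ j ∂Λ K| ≤ C * θ ^ K) ∧
      (∃ g : ℕ → ℝ → ℝ, (∀ K, Continuous (g K)) ∧
        (∀ (K : ℕ) (x y : ℝ), x ∈ Set.Icc (-1 : ℝ) 1 → y ∈ Set.Icc (-1 : ℝ) 1 → |g K x - g K y| ≤ 1 * |x - y|) ∧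
        (∀ (K : ℕ) (x : ℝ), x ∈ Set.Icc (-1 : ℝ) 1 → |g K x| ≤ 1) ∧
        ¬ Summable (fun K => |∫ x, g K x ∂Λ (K + 1) - ∫ x, g K x ∂Λ K|)) ∧
      ∀ (G : ℝ → ℝ) (KG BG : ℝ), Continuous G →
        (∀ x y : ℝ, x ∈ Set.Icc (-1 : ℝ) 1 → y ∈ Set.Icc (-1 : ℝ) 1 → |G x - G y| ≤ KG * |x - y|) →
        (∀ x : ℝ, x ∈ Set.Icc (-1 : ℝ) 1 → |G x| ≤ BG) →
        Summable (fun K => |∫ x, G x ∂Λ (K + 1) - ∫ x, G x ∂Λ K|) ∧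
          ∑' K, |∫ x, G x ∂Λ (K + 1) - ∫ x, G x ∂Λ K| ≤ π ^ 3 / 3 * (KG + BG) := by
  classical
  -- the half-scale arc laws WITH identities at the levels `3 + j`
  choose P Q iP iQ hPc hQc hsub hadd hmomEq hmom g hgc hgL hgB hpay using
    fun j : ℕ => exists_halfScale_chebyshevArc_laws_ident (n := 3 + j) (by omega)
  haveI : ∀ j, IsProbabilityMeasure (P j) := iP
  haveI : ∀ j, IsProbabilityMeasure (Q j) := iQ
  set r : ℕ → ℝ := fun K => C * θ ^ K with hrdef
  have hr : ∀ K, 0 < r K := fun K => by positivity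
  have hanti : Antitone r := fun K K' h => mul_le_mul_of_nonneg_left (pow_le_pow_of_le_one hθ0.le hθ1.le h) hC.le
  -- the distance of every moment to the common base at level `3 + j`
  set b : ℕ → ℝ := fun j => 2 * (1 / 2 : ℝ) ^ (3 + j) with hbdef
  have hb_mono : ∀ {i j : ℕ}, i ≤ j → b j ≤ b i := fun {i j} hij =>
    mul_le_mul_of_nonneg_left (pow_le_pow_of_le_one (by norm_num) (by norm_num) (by omega)) (by norm_num)
  have hcost_small : ∀ x : ℝ, 0 < x → ∃ j : ℕ, 2 * b j ≤ x := by
    intro x hx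
    obtain ⟨m, hm⟩ := exists_pow_lt_of_lt_one hx (by norm_num : (1 / 2 : ℝ) < 1)
    refine ⟨m, ?_⟩
    have e : 2 * b m = (1 / 2 : ℝ) ^ m * (1 / 2) := by simp only [hbdef]; rw [pow_add]; ring
    rw [e]
    nlinarith [pow_nonneg (by norm_num : (0 : ℝ) ≤ 1 / 2) m]
  -- the level of the budget `J i`, and the strictly increasing levels `ℓ i = J i + i`
  have hex : ∀ i : ℕ, ∃ j : ℕ, 2 * b j ≤ r (2 * i + 1) := fun i => hcost_small _ (hr _)
  let J : ℕ → ℕ := fun i => Nat.find (hex i)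
  have hJspec : ∀ i, 2 * b (J i) ≤ r (2 * i + 1) := fun i => Nat.find_spec (hex i)
  have hJmin : ∀ i j, j < J i → r (2 * i + 1) < 2 * b j := fun i j hj => not_le.1 (Nat.find_min (hex i) hj)
  have hJmono : ∀ i, J i ≤ J (i + 1) := fun i => Nat.find_min' (hex i) ((hJspec (i + 1)).trans (hanti (by omega)))
  let ℓ : ℕ → ℕ := fun i => J i + i
  have hℓ_strict : StrictMono ℓ := strictMono_nat_of_lt_succ fun i => by
    show J i + i < J (i + 1) + (i + 1)
    have := hJmono i
    omega
  have hℓJ : ∀ i, J i ≤ ℓ i := fun i => Nat.le_add_right _ _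
  -- every step costs `≤ 2 b (J i)` in EVERY moment: same level, or up the levels
  have hPQ' : ∀ j k : ℕ, |∫ x, x ^ k ∂Q j - ∫ x, x ^ k ∂P j| ≤ 2 * b j := fun j k => by
    obtain ⟨h1, h2⟩ := hmom j k
    calc |∫ x, x ^ k ∂Q j - ∫ x, x ^ k ∂P j|
        ≤ |∫ x, x ^ k ∂Q j - 1 / 2 * ∫ x in (-1 : ℝ)..1, (x / 2) ^ k| +
          |1 / 2 * (∫ x in (-1 : ℝ)..1, (x / 2) ^ k) - ∫ x, x ^ k ∂P j| := abs_sub_le _ _ _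
      _ = |∫ x, x ^ k ∂Q j - 1 / 2 * ∫ x in (-1 : ℝ)..1, (x / 2) ^ k| +
          |∫ x, x ^ k ∂P j - 1 / 2 * ∫ x in (-1 : ℝ)..1, (x / 2) ^ k| := by rw [abs_sub_comm (1 / 2 * _) _]
      _ ≤ b j + b j := add_le_add h2 h1
      _ = 2 * b j := by ring
  have hQP' : ∀ i j k : ℕ, i ≤ j → |∫ x, x ^ k ∂P j - ∫ x, x ^ k ∂Q i| ≤ 2 * b i := fun i j k hij => by
    obtain ⟨h1, -⟩ := hmom j k
    obtain ⟨-, h2⟩ := hmom i k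
    calc |∫ x, x ^ k ∂P j - ∫ x, x ^ k ∂Q i|
        ≤ |∫ x, x ^ k ∂P j - 1 / 2 * ∫ x in (-1 : ℝ)..1, (x / 2) ^ k| +
          |1 / 2 * (∫ x in (-1 : ℝ)..1, (x / 2) ^ k) - ∫ x, x ^ k ∂Q i| := abs_sub_le _ _ _
      _ = |∫ x, x ^ k ∂P j - 1 / 2 * ∫ x in (-1 : ℝ)..1, (x / 2) ^ k| +
          |∫ x, x ^ k ∂Q i - 1 / 2 * ∫ x in (-1 : ℝ)..1, (x / 2) ^ k| := by rw [abs_sub_comm (1 / 2 * _) _]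
      _ ≤ b j + b i := add_le_add h1 h2
      _ ≤ 2 * b i := by linarith [hb_mono hij]
  -- the sequence
  set Λ : ℕ → Measure ℝ := fun K => if Even K then P (ℓ (K / 2)) else Q (ℓ (K / 2)) with hΛ
  have hΛP : ∀ K, IsProbabilityMeasure (Λ K) := fun K => by simp only [hΛ]; split_ifs <;> infer_instance
  have hΛc : ∀ K, Λ K (Set.Icc (-1 : ℝ) 1)ᶜ = 0 := fun K => by simp only [hΛ]; split_ifs; exacts [hPc _, hQc _]
  refine ⟨Λ, hΛP, hΛc, fun K k => ?_, ⟨fun K => g (ℓ (K / 2)), fun K => hgc _, fun K x y hx hy => hgL _ x y hx hy,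
    fun K x hx => (hgB _ x hx).trans ?_, fun hSum => ?_⟩, fun G KG BG hG hK hB => ?_⟩
  · -- uniform moment matching: the step cost `2 b (J (K∕2))` fits the budget `r K`
    have hstep : |∫ x, x ^ k ∂Λ (K + 1) - ∫ x, x ^ k ∂Λ K| ≤ 2 * b (J (K / 2)) := by
      rcases Nat.even_or_odd K with ⟨i, rfl⟩ | ⟨i, rfl⟩
      · have h1 : ¬Even (i + i + 1) := by rw [Nat.not_even_iff_odd]; exact ⟨i, by ring⟩
        have e1 : (i + i) / 2 = i := by omega
        have e2 : (i + i + 1) / 2 = i := by omega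
        simp only [hΛ, Even.add_self i, if_true, h1, if_false, e1, e2]
        exact (hPQ' (ℓ i) k).trans (by linarith [hb_mono (hℓJ i)])
      · have h0 : ¬Even (2 * i + 1) := Nat.not_even_iff_odd.2 ⟨i, rfl⟩
        have h1 : Even (2 * i + 1 + 1) := ⟨i + 1, by ring⟩
        have e1 : (2 * i + 1) / 2 = i := by omega
        have e2 : (2 * i + 1 + 1) / 2 = i + 1 := by omega
        simp only [hΛ, h0, if_false, h1, if_true, e1, e2]
        exact (hQP' (ℓ i) (ℓ (i + 1)) k (hℓ_strict.monotone (Nat.le_succ i))).trans (by linarith [hb_mono (hℓJ i)])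
    have hbud : 2 * b (J (K / 2)) ≤ r K := by
      rcases Nat.even_or_odd K with ⟨i, rfl⟩ | ⟨i, rfl⟩
      · have e1 : (i + i) / 2 = i := by omega
        rw [e1]
        exact (hJspec i).trans (hanti (by omega))
      · have e1 : (2 * i + 1) / 2 = i := by omega
        rw [e1]
        exact hJspec i
    exact hstep.trans hbud
  · -- `1∕(4(3 + ℓ)) ≤ 1`
    rw [div_le_one (by positivity)]
    have : (1 : ℝ) ≤ ((3 + ℓ (K / 2) : ℕ) : ℝ) := by exact_mod_cast (by omega : 1 ≤ 3 + ℓ (K / 2))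
    linarith
  · -- (a) NOT SUMMABLE.  The even steps pay exactly `1∕(4(3 + ℓ i))`.
    have h2 : Summable (fun i : ℕ => |∫ x, g (ℓ ((2 * i) / 2)) x ∂Λ (2 * i + 1) - ∫ x, g (ℓ ((2 * i) / 2)) x ∂Λ (2 * i)|) :=
      hSum.comp_injective (fun a c h => by simpa using h : Function.Injective fun i : ℕ => 2 * i)
    have h3 : ∀ i : ℕ, |∫ x, g (ℓ ((2 * i) / 2)) x ∂Λ (2 * i + 1) - ∫ x, g (ℓ ((2 * i) / 2)) x ∂Λ (2 * i)| =
        1 / (4 * ((3 + ℓ i : ℕ) : ℝ)) := by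
      intro i
      have h0 : ¬Even (2 * i + 1) := Nat.not_even_iff_odd.2 ⟨i, rfl⟩
      have e1 : 2 * i / 2 = i := by omega
      have e2 : (2 * i + 1) / 2 = i := by omega
      simp only [hΛ, even_two_mul, if_true, h0, if_false, e1, e2]
      rw [abs_sub_comm, hpay (ℓ i), abs_of_pos (by positivity)]
    simp_rw [h3] at h2
    -- the rates, antitone in `K`
    set ρ : ℕ → ℝ := fun K => 1 / (1 + Real.posLog (r K)⁻¹) with hρdef
    have hρ0 : ∀ K, 0 ≤ ρ K := fun K => (invLogRate_pos _).le
    have hρ_anti : ∀ {K K' : ℕ}, K ≤ K' → ρ K' ≤ ρ K := fun {K K'} h => invLogRate_posLog_inv_mono (hr K') (hanti h)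
    -- THE INVERSION: `3 + J i + i ≤ M₀ (1 + L)`, `L = log⁺ (r (2i+1))⁻¹`
    set lam : ℝ := Real.log θ⁻¹ with hlam
    have hlam_pos : 0 < lam := Real.log_pos ((one_lt_inv₀ hθ0).2 hθ1)
    set M₀ : ℝ := max (3 + |Real.log C| / (2 * lam)) (2 + 1 / (2 * lam)) with hM₀
    have hM₀pos : 0 < M₀ := lt_max_of_lt_right (by positivity)
    have hkey : ∀ i : ℕ, (1 / (4 * M₀)) * ρ (2 * i + 1) ≤ 1 / (4 * ((3 + ℓ i : ℕ) : ℝ)) := by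
      intro i
      set L : ℝ := Real.posLog (r (2 * i + 1))⁻¹ with hL
      have hL0 : 0 ≤ L := Real.posLog_nonneg
      -- `J i ≤ 2 L`
      have hJ : (J i : ℝ) ≤ 2 * L := by
        by_cases hJ0 : J i = 0
        · rw [hJ0]; push_cast; linarith
        · obtain ⟨m, hm⟩ := Nat.exists_eq_succ_of_ne_zero hJ0
          have hlt := hJmin i m (by omega)
          have e : 2 * b m = (1 / 2 : ℝ) ^ (m + 1) := by simp only [hbdef]; rw [pow_add, pow_succ]; ring
          rw [e] at hlt
          have hrpos := hr (2 * i + 1)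
          have hinv : (2 : ℝ) ^ (m + 1) ≤ (r (2 * i + 1))⁻¹ := by
            rw [show (2 : ℝ) ^ (m + 1) = ((1 / 2 : ℝ) ^ (m + 1))⁻¹ by rw [one_div, inv_pow, inv_inv]]
            exact inv_anti₀ hrpos hlt.le
          have hlog : ((m : ℝ) + 1) * Real.log 2 ≤ L := by
            have h1 : Real.log ((2 : ℝ) ^ (m + 1)) ≤ Real.log (r (2 * i + 1))⁻¹ := Real.log_le_log (by positivity) hinv
            rw [Real.log_pow] at h1
            push_cast at h1
            exact h1.trans (by rw [hL, Real.posLog_apply]; exact le_max_right _ _)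
          rw [hm]
          push_cast
          nlinarith [Real.log_two_gt_d9]
      -- `i ≤ (L + |log C|)∕(2 lam)`: `log r⁻¹ = −log C + (2i+1)·lam ≤ L`
      have hi : (i : ℝ) ≤ (L + |Real.log C|) / (2 * lam) := by
        have e : Real.log (r (2 * i + 1))⁻¹ = -Real.log C + (2 * i + 1) * lam := by
          simp only [hrdef, hlam]
          rw [mul_inv, Real.log_mul (inv_ne_zero hC.ne') (inv_ne_zero (pow_ne_zero _ hθ0.ne')), Real.log_inv, ← inv_pow,
            Real.log_pow]
          push_cast
          ring
        have h1 : Real.log (r (2 * i + 1))⁻¹ ≤ L := by rw [hL, Real.posLog_apply]; exact le_max_right _ _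
        rw [e] at h1
        have h2 : -Real.log C ≥ -|Real.log C| := neg_le_neg_iff.2 (le_abs_self _) |>.ge
        rw [le_div_iff₀ (by positivity)]
        nlinarith
      -- assemble: `3 + J i + i ≤ M₀ (1 + L)`
      have hsum : ((3 + ℓ i : ℕ) : ℝ) ≤ M₀ * (1 + L) := by
        have hA : 3 + |Real.log C| / (2 * lam) ≤ M₀ := le_max_left _ _
        have hBc : 2 + 1 / (2 * lam) ≤ M₀ := le_max_right _ _
        have e1 : ((3 + ℓ i : ℕ) : ℝ) = 3 + J i + i := by push_cast; simp only [ℓ]; push_cast; ring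
        rw [e1]
        have hi' : (i : ℝ) ≤ L / (2 * lam) + |Real.log C| / (2 * lam) := by rw [← add_div]; exact hi
        have hL2 : L / (2 * lam) = (1 / (2 * lam)) * L := by ring
        rw [hL2] at hi'
        nlinarith [mul_nonneg (sub_nonneg.2 hBc) hL0, mul_nonneg (sub_nonneg.2 hA) zero_le_one]
      have hpos3 : (0 : ℝ) < ((3 + ℓ i : ℕ) : ℝ) := by positivity
      rw [hρdef]
      rw [show (1 / (4 * M₀)) * (1 / (1 + L)) = 1 / (4 * (M₀ * (1 + L))) by field_simp]
      exact one_div_le_one_div_of_le (by positivity) (by nlinarith)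
    -- summability transfer: odd rates, then even rates, then all rates — contradiction with module 79
    have hodd : Summable (fun i : ℕ => ρ (2 * i + 1)) := by
      have hc0 : (0 : ℝ) < 1 / (4 * M₀) := by positivity
      have h1 : Summable (fun i : ℕ => (1 / (4 * M₀)) * ρ (2 * i + 1)) :=
        Summable.of_nonneg_of_le (fun i => mul_nonneg hc0.le (hρ0 _)) hkey h2
      exact (summable_mul_left_iff hc0.ne').1 h1
    have heven : Summable (fun i : ℕ => ρ (2 * i)) := by
      have h1 : Summable (fun i : ℕ => ρ (2 * (i + 1))) :=
        Summable.of_nonneg_of_le (fun i => hρ0 _) (fun i => hρ_anti (by omega)) hodd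
      exact (summable_nat_add_iff 1).1 h1
    exact not_summable_invLogRate_geometric C θ (Summable.even_add_odd heven hodd)
  · -- (b) EVERY FIXED TEST: module 88's arc-chain bound with `s = ½`, candidates `P (ℓ (K∕2)), Q (ℓ (K∕2))` at level `3 + ℓ (K∕2)`, multiplicity `2`
    have hs : |(1 / 2 : ℝ)| ≤ 1 := by rw [abs_of_pos (by norm_num)]; norm_num
    have hbound : ∀ L : ℕ, ∑ K ∈ Finset.range L, |∫ x, G x ∂Λ (K + 1) - ∫ x, G x ∂Λ K| ≤ π ^ 3 / 3 * (KG + BG) := by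
      intro L
      have h := sum_abs_increments_arcChain_le (P := fun K => P (ℓ (K / 2))) (Q := fun K => Q (ℓ (K / 2)))
        (lev := fun K => 3 + ℓ (K / 2)) (σ := fun K => Even K) (m := 2) hs
        (fun K f hf => hsub (ℓ (K / 2)) f hf) (fun K f hf => hadd (ℓ (K / 2)) f hf)
        (fun n L' => card_filter_level_le_two hℓ_strict n L') hG hK hB L
      simp only [hΛ] at h ⊢
      refine h.trans (le_of_eq ?_)
      push_cast
      ring
    exact ⟨summable_of_sum_range_le (fun _ => abs_nonneg _) hbound, Real.tsum_le_of_sum_range_le (fun _ => abs_nonneg _) hbound⟩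

end Summit.QuantumFields.YangMills.Theorems.BalabanUVNodesN19UniformMomentsFixedTestsSummable

end
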